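import Literature.NumberTheory.Automorphic.ParabolicIndGLNoSupercuspidalSubquotient
import Literature.NumberTheory.Automorphic.JacquetFiniteLengthCriterion
import HarnessLib

/-!
# Finite length of `i_c σ` from the finite length of its Jacquet modules
(Bernstein–Zelevinsky 1977, §2.14; Casselman 1995, Cor. 6.3.7 — the `GL_n` assembly)

For a proper standard parabolic `P_c < GL_n(F)` and an irreducible admissible representation
`σ` of its Levi, the induced representation `i_c σ` has finite length over `ℂ[GL_n(F)]` **as soon
as all its proper Jacquet modules `r_{c'}(i_c σ)` have finite length**
(`Literature.NumberTheory.Automorphic.isFiniteLength_parabolicIndGL_of_jacquetGL`): the counting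
criterion `isFiniteLength_of_jacquetGL` (Bernstein–Zelevinsky 1977, §2.14 (2); Casselman 1995,
proof of Cor. 6.3.7) applies because `i_c σ` is smooth and has no irreducible supercuspidal
subquotient (Casselman 1995, Cor. 5.4.3, `intertwiningMap_subrepresentation_parabolicIndGL_eq_zero`).
The remaining input — the finite length of `r_{c'}(i_c σ)` for `σ` cuspidal — is the
Geometrical Lemma (Bernstein–Zelevinsky 1977, 2.12–2.13; Casselman 1995, Thm. 6.3.5), not treated
here. Theorems only; no definitions, no named facts.

## References

* I. N. Bernstein, A. V. Zelevinsky, *Induced representations of reductive `p`-adic groups I*,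
  Ann. Sci. ÉNS (4) 10 (1977), §2.14, p. 449. [BernsteinZelevinsky1977]
* W. Casselman, *Introduction to the theory of admissible representations of `p`-adic reductive
  groups* (draft 1 May 1995), Cor. 5.4.3, Cor. 6.3.7, pp. 50, 59–60. [Casselman1995]
-/

noncomputable section

open scoped MatrixGroups MonoidAlgebra

namespace Literature.NumberTheory.Automorphic

open Representation

universe v

variable {F : Type*} [Field F] [ValuativeRel F] [TopologicalSpace F] [IsNonarchimedeanLocalField F]
  {n r : ℕ} {c : Fin n → Fin r} {W : Type v} [AddCommGroup W] [Module ℂ W]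
  {σ : Representation ℂ (Π a, GL {i // c i = a} F) W}

/-- **Finite length of `i_c σ` from its Jacquet modules** (Bernstein–Zelevinsky 1977, §2.14;
Casselman 1995, proof of Cor. 6.3.7): for a proper monotone block labelling `c`, a representation
`σ` of the Levi acting by scalars on the central scalars `u · 1`, and `i_c σ` with all proper
Jacquet modules of finite length, `i_c σ` has finite length over `ℂ[GL_n(F)]`.
[cite: BernsteinZelevinsky1977, §2.14] -/
theorem isFiniteLength_parabolicIndGL_of_jacquetGL_of_scalar (hcm : Monotone c)
    (hcp : IsProperBlocks c)
    (hσZ : ∀ u : Fˣ, ∃ cu : ℂ, ∀ w,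
      σ (leviProjection F c ⟨_, scalar_mem_standardParabolicGL c u⟩) w = cu • w)
    (hfin : ∀ (r' : ℕ) (c' : Fin n → Fin r'), IsProperBlocks c' → Monotone c' →
      IsFiniteLength ℂ[Π a, GL {i // c' i = a} F]
        (jacquetGL F c' (parabolicIndGL F c σ)).asModule) :
    IsFiniteLength ℂ[GL (Fin n) F] (parabolicIndGL F c σ).asModule :=
  isFiniteLength_of_jacquetGL (isSmooth_smoothInd _ _) hfin
    fun N₀ _ _ _ _ _ hτa hτc q =>
      intertwiningMap_subrepresentation_parabolicIndGL_eq_zero hcm hcp hσZ hτa hτc N₀ q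

/-- **Finite length of `i_c σ` from its Jacquet modules**, `σ` irreducible admissible
(Casselman 1995, Cor. 6.3.7 modulo Thm. 6.3.5): for a proper monotone `c` and an irreducible
admissible `σ` of the Levi, if all proper Jacquet modules `r_{c'}(i_c σ)` have finite length then
`i_c σ` has finite length over `ℂ[GL_n(F)]`. [cite: Casselman1995, Cor. 6.3.7] -/
theorem isFiniteLength_parabolicIndGL_of_jacquetGL (hcm : Monotone c) (hcp : IsProperBlocks c)
    [σ.IsIrreducible] (hσ : σ.IsAdmissible)
    (hfin : ∀ (r' : ℕ) (c' : Fin n → Fin r'), IsProperBlocks c' → Monotone c' →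
      IsFiniteLength ℂ[Π a, GL {i // c' i = a} F]
        (jacquetGL F c' (parabolicIndGL F c σ)).asModule) :
    IsFiniteLength ℂ[GL (Fin n) F] (parabolicIndGL F c σ).asModule :=
  isFiniteLength_parabolicIndGL_of_jacquetGL_of_scalar hcm hcp
    (exists_apply_leviProjection_scalar_eq_smul σ hσ) hfin

end Literature.NumberTheory.Automorphic
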